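import Summits.ValiantsHypothesis.ValiantsHypothesis.Theorems.KPlusLogSqLawTropicalBChangedSetLaw

/-!
# Route «KPlusLogSqLaw», crux `TropicalB` (stmt-ValiantsHypothesis-19771) — the UNIFORM super-fat row
# `2(T(m,K)+1) ≤ 2·m! + 5·m!·(K−1)`: an ABSOLUTE number of terms per permutation and slope class

HONEST FRAMING.  Helper toward the crux `Summit.ValiantsHypothesis.ValiantsHypothesis.Theses.KPlusLogSqLaw.TropicalB` (ledger item
`stmt-ValiantsHypothesis-19771`, registered stubs `stub_tropThin` / `stub_tropFat` of `Cruxes/TropicalB/Lines/birth.lean`; cell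
`pub-symmetroid`, seat val-sym-trop-p4 g5, 2026-08-27; `--supports … --as helper`).  Sequel of `…TropicalBChangedSetLaw` (imported): the
changed-set law `(R+1)(n+1) ≤ (R+1)|Π| + (K−1)·(Σ_{r=1}^{R}(R+1−r)·N_r + m|Π|)` at `R + 1 = ⌈m/2⌉` plus elementary arithmetic.  A bound in the
SUPER-FAT corner `K ≫ m`, OFF the window `⌊log₂ m⌋ + 1 < K < m` of the crux; nothing here bears on `TropicalB` in the window, on `WeakLifting`
/ `Lifting`, on the cell's real census / DoorA26 / DoorA34, on `MatrixDescartes` (stmt-ValiantsHypothesis-18050) or on VP ≠ VNP.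
`T(m,K)` = the least `B` with `TropRootLawAt m K B`.

CONTENT.
* `key_ineq`: `2·(Σ_{r=1}^{R}(R+1−r)·C(m,r)·m!/(m−r)! + m!·m) ≤ 5(R+1)·m!` at `R + 1 = ⌈m/2⌉`, for every `m ≥ 1` — by kernel evaluation for
  `m ≤ 21` (`key_ineq_small`) and termwise for `m ≥ 22`: `2(R+1−r)·C(m,r) ≤ (m+1)·2^m ≤ (⌊m/2⌋+1)! ≤ (m−r)!` (`two_mul_term_le_factorial`,
  `succ_mul_two_pow_le_factorial`).
* `tropRootLawAt_fiveHalves` (UNIFORM ROW): `2(T(m,K)+1) ≤ 2·m! + 5·m!·(K−1)` for EVERY format, i.e. `T(m,K) ≤ m! − 1 + ⌊5·m!·(K−1)/2⌋`: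
  the number of chain terms per permutation and slope class is bounded by the ABSOLUTE constant `5/2`, where the thin law
  `T(m,K)+1 ≤ m!·(m(K−1)+1)` (p406287) has `m` and the half-thin law `2(T(m,K)+1) ≤ 2·m! + (m!·m + m²)(K−1)` (p476649) has `m/2`;
  `fiveHalves_le_halfThin`: below the half-thin row for every `m ≥ 5` (for `m ≤ 4` the optimal `R` is `1` and the half-thin row is better:
  `tropRootLawAt_three_fiveHalves` gives only `T(3,K) ≤ 15K − 10` against `⌊(27K−17)/2⌋`).
Paper remarks (not typed): with the optimal `R ≈ m − e√m` the constant `5/2` becomes `1 + O(1/√m)`; the worst ratio over all `m` of the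
changed-set bound is `2.361…` (at `m = 5`), so `5/2` is within 6 % of what the method gives.  Whether the true slope of the `m`-row grows
like `m!` or polynomially in `m` is OPEN (`T(2,K) = 4K − 7`; `6K − 11 ≤ T(3,K) ≤ ⌊(27K−17)/2⌋`).  [this cell]
-/

-- `Summit.ValiantsHypothesis.ValiantsHypothesis.…` repeats a component by the D-0017 layout
-- (single-conjunct summit), which the `dupNamespace` linter flags; the name is mandated.
set_option linter.dupNamespace false
set_option autoImplicit false

namespace Summit.ValiantsHypothesis.ValiantsHypothesis.Theorems.KPlusLogSqLaw

open Summit.ValiantsHypothesis.ValiantsHypothesis.Theorems.MatrixDescartes.Negative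
open Summit.ValiantsHypothesis.ValiantsHypothesis.Theorems.LacunarySymmetroidMatrixDescartes.TropicalCensus
open Finset

namespace RefreshExclusivity

/-! ## The uniform row `2(T(m,K)+1) ≤ 2·m! + 5·m!·(K−1)` -/

/-- arithmetic: `(2t+2)·2^(2t+1) ≤ (t+1)!` for `t ≥ 11`. -/
theorem two_pow_le_factorial_aux {t : ℕ} (ht : 11 ≤ t) : (2 * t + 2) * 2 ^ (2 * t + 1) ≤ (t + 1).factorial := by
  induction t, ht using Nat.le_induction with
  | base => decide
  | succ t _ ih =>
    have h2 : 4 * (2 * t + 4) ≤ (t + 2) * (2 * t + 2) := by nlinarith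
    calc (2 * (t + 1) + 2) * 2 ^ (2 * (t + 1) + 1) = 4 * (2 * t + 4) * 2 ^ (2 * t + 1) := by ring
      _ ≤ (t + 2) * (2 * t + 2) * 2 ^ (2 * t + 1) := Nat.mul_le_mul_right _ h2
      _ = (t + 2) * ((2 * t + 2) * 2 ^ (2 * t + 1)) := by ring
      _ ≤ (t + 2) * (t + 1).factorial := Nat.mul_le_mul_left _ ih
      _ = (t + 1 + 1).factorial := by rw [Nat.factorial_succ (t + 1)]

/-- arithmetic: `(m+1)·2^m ≤ (⌊m/2⌋+1)!` for `m ≥ 22`. -/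
theorem succ_mul_two_pow_le_factorial {m : ℕ} (hm : 22 ≤ m) : (m + 1) * 2 ^ m ≤ (m / 2 + 1).factorial := by
  obtain ⟨t, ht⟩ : ∃ t, m = 2 * t ∨ m = 2 * t + 1 := ⟨m / 2, by omega⟩
  rcases ht with rfl | rfl
  · have ht : 11 ≤ t := by omega
    have e : 2 * t / 2 = t := by omega
    rw [e]
    calc (2 * t + 1) * 2 ^ (2 * t) ≤ (2 * t + 2) * 2 ^ (2 * t + 1) :=
          Nat.mul_le_mul (by omega) (Nat.pow_le_pow_right (by norm_num) (by omega))
      _ ≤ (t + 1).factorial := two_pow_le_factorial_aux ht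
  · have ht : 11 ≤ t := by omega
    have e : (2 * t + 1) / 2 = t := by omega
    rw [e, show 2 * t + 1 + 1 = 2 * t + 2 by ring]
    exact two_pow_le_factorial_aux ht

/-- termwise bound for `m ≥ 22`: with `R + 1 = ⌈m/2⌉` and `r ≤ R`, `2(R+1−r)·C(m,r)·m!/(m−r)! ≤ m!`
(`C(m,r) ≤ 2^m`, `(m+1)·2^m ≤ (⌊m/2⌋+1)! ≤ (m−r)!`). -/
theorem two_mul_term_le_factorial {m R r : ℕ} (hm : 22 ≤ m) (hR : (m + 1) / 2 = R + 1) (hr : r ≤ R) :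
    2 * ((R + 1 - r) * (m.choose r * m.descFactorial r)) ≤ m.factorial := by
  have hrm : r ≤ m := by omega
  have hmr : m / 2 + 1 ≤ m - r := by omega
  have h1 : 2 * (R + 1 - r) * m.choose r ≤ (m - r).factorial :=
    calc 2 * (R + 1 - r) * m.choose r ≤ (m + 1) * 2 ^ m := Nat.mul_le_mul (by omega) (Nat.choose_le_two_pow m r)
      _ ≤ (m / 2 + 1).factorial := succ_mul_two_pow_le_factorial hm
      _ ≤ (m - r).factorial := Nat.factorial_le hmr
  calc 2 * ((R + 1 - r) * (m.choose r * m.descFactorial r))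
      = (2 * (R + 1 - r) * m.choose r) * m.descFactorial r := by ring
    _ ≤ (m - r).factorial * m.descFactorial r := Nat.mul_le_mul_right _ h1
    _ = m.factorial := Nat.factorial_mul_descFactorial hrm

/-- the key arithmetic inequality at `R + 1 = ⌈m/2⌉`, large sizes: `2(Σ_{r ≤ R}(R+1−r)N_r + m!·m) ≤ 5(R+1)·m!` for `m ≥ 22`. -/
theorem key_ineq_large {m R : ℕ} (hm : 22 ≤ m) (hR : (m + 1) / 2 = R + 1) :
    2 * ((∑ r ∈ Icc 1 R, (R + 1 - r) * (m.choose r * m.descFactorial r)) + m.factorial * m) ≤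
      5 * (R + 1) * m.factorial := by
  have hsum : 2 * (∑ r ∈ Icc 1 R, (R + 1 - r) * (m.choose r * m.descFactorial r)) ≤ R * m.factorial := by
    rw [Finset.mul_sum]
    calc ∑ r ∈ Icc 1 R, 2 * ((R + 1 - r) * (m.choose r * m.descFactorial r))
        ≤ ∑ _r ∈ Icc 1 R, m.factorial :=
          Finset.sum_le_sum fun r hr => two_mul_term_le_factorial hm hR (Finset.mem_Icc.mp hr).2
      _ = R * m.factorial := by rw [Finset.sum_const, smul_eq_mul, Nat.card_Icc, Nat.add_sub_cancel]
  have h3 : (R + 2 * m) * m.factorial ≤ (5 * (R + 1)) * m.factorial := Nat.mul_le_mul_right _ (by omega)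
  calc 2 * ((∑ r ∈ Icc 1 R, (R + 1 - r) * (m.choose r * m.descFactorial r)) + m.factorial * m)
      = 2 * (∑ r ∈ Icc 1 R, (R + 1 - r) * (m.choose r * m.descFactorial r)) + 2 * m * m.factorial := by ring
    _ ≤ R * m.factorial + 2 * m * m.factorial := Nat.add_le_add_right hsum _
    _ = (R + 2 * m) * m.factorial := by ring
    _ ≤ (5 * (R + 1)) * m.factorial := h3
    _ = 5 * (R + 1) * m.factorial := by ring

/-- the key arithmetic inequality at `R + 1 = ⌈m/2⌉`, sizes `1 ≤ m ≤ 21` (kernel evaluation). -/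
theorem key_ineq_small : ∀ m ∈ Icc 1 21, ∀ R ∈ range 11, (m + 1) / 2 = R + 1 →
    2 * ((∑ r ∈ Icc 1 R, (R + 1 - r) * (m.choose r * m.descFactorial r)) + m.factorial * m) ≤
      5 * (R + 1) * m.factorial := by
  decide

/-- the key arithmetic inequality at `R + 1 = ⌈m/2⌉`, all sizes `m ≥ 1`. -/
theorem key_ineq {m R : ℕ} (hm : 1 ≤ m) (hR : (m + 1) / 2 = R + 1) :
    2 * ((∑ r ∈ Icc 1 R, (R + 1 - r) * (m.choose r * m.descFactorial r)) + m.factorial * m) ≤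
      5 * (R + 1) * m.factorial := by
  by_cases h : 22 ≤ m
  · exact key_ineq_large h hR
  · exact key_ineq_small m (Finset.mem_Icc.mpr ⟨hm, by omega⟩) R (Finset.mem_range.mpr (by omega)) hR

/-- **UNIFORM SUPER-FAT ROW.**  For every format: `2(T(m,K)+1) ≤ 2·m! + 5·m!·(K−1)`, i.e.
`T(m,K) ≤ m! − 1 + ⌊5·m!·(K−1)/2⌋` — at most `5/2` revisits per permutation and slope class, with NO factor `m`; compare the thin
law `T(m,K) + 1 ≤ m!·(m(K−1)+1)` (p406287) and the half-thin law `2(T(m,K)+1) ≤ 2·m! + (m!·m + m²)(K−1)` (p476649), which this row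
beats for every `m ≥ 5`.  Proof: the changed-set law at `R + 1 = ⌈m/2⌉` and the arithmetic `key_ineq`.  (The optimal `R ≈ m − e√m`
gives `(1 + O(1/√m))·m!` per class — not typed.)  A super-fat-corner bound (`K ≫ m`), off the window of the crux.
[this cell, val-sym-trop-p4 g5] -/
theorem tropRootLawAt_fiveHalves (m K : ℕ) :
    TropRootLawAt m K (m.factorial - 1 + 5 * (m.factorial * (K - 1)) / 2) := by
  rcases Nat.eq_zero_or_pos m with rfl | hm
  · refine tropRootLawAt_mono ?_ (tropRootLawAt_changedSet 0 K 0)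
    simp
  obtain ⟨R, hR⟩ : ∃ R, (m + 1) / 2 = R + 1 := ⟨(m + 1) / 2 - 1, by omega⟩
  intro d v ε n θ p _hε hθ hdom halt
  classical
  have hlaw := succ_mul_succ_le_changedSet d v ε θ p hθ hdom halt R
  have hPi : (univ.image fun k => (p k).1).card ≤ m.factorial :=
    (Finset.card_le_univ _).trans (le_of_eq (by rw [Fintype.card_perm, Fintype.card_fin]))
  have hkey := key_ineq hm hR
  have h2 : (R + 1) * (2 * (n + 1)) ≤ (R + 1) * (2 * m.factorial + 5 * (m.factorial * (K - 1))) := by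
    have h1 : (R + 1) * (n + 1) ≤ (R + 1) * m.factorial + (K - 1) *
        ((∑ r ∈ Icc 1 R, (R + 1 - r) * (m.choose r * m.descFactorial r)) + m.factorial * m) := by
      refine hlaw.trans (Nat.add_le_add (Nat.mul_le_mul_left _ hPi) (Nat.mul_le_mul_left _ ?_))
      exact Nat.add_le_add_left (Nat.mul_le_mul_right _ hPi) _
    have h3 : (K - 1) * (2 * ((∑ r ∈ Icc 1 R, (R + 1 - r) * (m.choose r * m.descFactorial r)) + m.factorial * m)) ≤
        (K - 1) * (5 * (R + 1) * m.factorial) := Nat.mul_le_mul_left _ hkey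
    calc (R + 1) * (2 * (n + 1)) = 2 * ((R + 1) * (n + 1)) := by ring
      _ ≤ 2 * ((R + 1) * m.factorial + (K - 1) *
          ((∑ r ∈ Icc 1 R, (R + 1 - r) * (m.choose r * m.descFactorial r)) + m.factorial * m)) :=
          Nat.mul_le_mul_left _ h1
      _ = 2 * ((R + 1) * m.factorial) + (K - 1) *
          (2 * ((∑ r ∈ Icc 1 R, (R + 1 - r) * (m.choose r * m.descFactorial r)) + m.factorial * m)) := by ring
      _ ≤ 2 * ((R + 1) * m.factorial) + (K - 1) * (5 * (R + 1) * m.factorial) := Nat.add_le_add_left h3 _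
      _ = (R + 1) * (2 * m.factorial + 5 * (m.factorial * (K - 1))) := by ring
  have h4 : 2 * (n + 1) ≤ 2 * m.factorial + 5 * (m.factorial * (K - 1)) := Nat.le_of_mul_le_mul_left h2 (Nat.succ_pos R)
  have hf : 1 ≤ m.factorial := m.factorial_pos
  generalize m.factorial * (K - 1) = X at h4 ⊢
  omega

/-- The uniform row at `m = 3`: `T(3,K) ≤ 5 + 15(K−1)` — WEAKER than the half-thin `m = 3` row `5 + ⌊27(K−1)/2⌋` (p476649), as
it must be: for `m ≤ 4` the optimal `R` is `1`; the uniform row is made for `m ≥ 5`. -/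
theorem tropRootLawAt_three_fiveHalves (K : ℕ) : TropRootLawAt 3 K (5 + 15 * (K - 1)) := by
  refine tropRootLawAt_mono (le_of_eq ?_) (tropRootLawAt_fiveHalves 3 K)
  simp [Nat.factorial]
  omega

/-- The uniform row is below the half-thin row `m! − 1 + ⌊(m!·m + m²)(K−1)/2⌋` (p476649) for every `m ≥ 5`. -/
theorem fiveHalves_le_halfThin {m : ℕ} (hm : 5 ≤ m) (K : ℕ) :
    m.factorial - 1 + 5 * (m.factorial * (K - 1)) / 2 ≤ m.factorial - 1 + (m.factorial * m + m ^ 2) * (K - 1) / 2 := by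
  refine Nat.add_le_add_left (Nat.div_le_div_right ?_) _
  calc 5 * (m.factorial * (K - 1)) = (5 * m.factorial) * (K - 1) := by ring
    _ ≤ (m.factorial * m + m ^ 2) * (K - 1) := Nat.mul_le_mul_right _ (by nlinarith [m.factorial_pos])

end RefreshExclusivity

end Summit.ValiantsHypothesis.ValiantsHypothesis.Theorems.KPlusLogSqLaw
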